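import Summits.QuantumFields.YangMills.Theorems.FlatTubeReductionRateKappa
import HarnessLib

/-!
# The NEAR/FAR THRESHOLD of the rate twin, eventually: the `α`-dependent smallness hypotheses of `…DressedFixedBeta.dressed_fixed_beta_estimate` for ANY threshold family
# `6·β^{-1/2} ≤ α_β ≤ btAlpha β` (and the choice `α_r = A·β^{-1/2}·√log β`)
# (route `FlatTubeReduction`, crux K1 `NearFlatRatioLaw` stmt-QuantumFields-24720; seat `ym-line-ftr-p1` g15; rate twin «ratepack-v3 / frozen fibres»; R2b1 RECORD rung — no summit
# statement is proved here)

WHY (NOTES T6c; memo `Cruxes/NearFlatRatioLaw/Lines/ratepack-v3-frozen-g12.md` §9).  Lane A's schedule (`…RateSchedule`, from `…BTRatesAtoms`) takes the near/far threshold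
`btAlpha = β^{-1/2}ℓ`; the rate twin needs a SMALLER threshold (`α_r = A·β^{-1/2}√ℓ`, so that the off-diagonal tail factor `e^{3Bα²} = β^{3L³A²}` stays polynomial).  The four
`α`-conjuncts of the fixed-`β` estimate are MONOTONE in `α` in the right direction except the far-junk inequality `hJ`, which only needs `α ≥ 6β^{-1/2}`:
* `coreEta_mono_alpha` — lane A's rate `η` is increasing in `α ≥ 0`;
* ★ `eventually_alpha_elementary_D` — `α ≤ 1`, the two defect margins and `hJ`, eventually, for any family `6·powScale(1/2) ≤ α ≤ btAlpha` (window `δ = D·recordDelta1 L (1/6)`, `D ≥ 1`);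
* ★ `eventually_coreEta_alpha_le_one_D` (`η(α) ≤ 1`), `eventually_le_one_of_le_C1C2`, ★ `eventually_symEta_alpha_le_one_D` (`η_s(α) ≤ 1`, fibre radius `powScale (1/2)` in the `t, R` slots);
* `alphaR_nonneg`, `alphaR_le_mul_btLog`, ★ `eventually_alphaR_le_btAlpha`, ★ `eventually_six_powScale_le_alphaR` — the family `α_r = A·powScale(1/2)·√btLog` qualifies (`A ≥ 1`).
HONEST FRAMING: real-analysis bookkeeping for a stub of the CONDITIONAL reduction route R2b1; femto rung R2b1 (RECORD label); not infinite volume, not a gap, not Clay.  No defs, no named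
facts, no `sorry`.
-/

set_option autoImplicit false

noncomputable section

open MeasureTheory Filter Topology Real
open scoped BigOperators
open Literature.MathematicalPhysics.QuantumFieldTheory
open Literature.MathematicalPhysics.QuantumLattice

namespace Summit.QuantumFields.YangMills.Theorems.FemtoTransferGap.TwoLattice.ConstTube

open Summit.QuantumFields.YangMills.Theorems.FemtoTransferGap
open Summit.QuantumFields.YangMills.Theorems.FemtoTransferGap.TwoLattice
open Summit.QuantumFields.YangMills.Theorems.FemtoTransferGap.TwoLattice.Avg
open Summit.QuantumFields.YangMills.Theorems.FemtoTransferGap.TwoLattice.Cov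

variable {L : ℕ} [NeZero L]

/-! ## §1 Monotonicity of lane A's rate in the threshold -/

/-- `η` (`coreEta`) is increasing in `α ≥ 0` (`β ≥ 0`, `δΓ ≥ 0`). [folklore] -/
theorem coreEta_mono_alpha {β δ α α' T R Γ σ : ℝ} (hβ : 0 ≤ β) (hδΓ : 0 ≤ δ * Γ) (hα0 : 0 ≤ α) (hαα : α ≤ α') :
    coreEta L β δ α T R Γ σ ≤ coreEta L β δ α' T R Γ σ := by
  unfold coreEta
  have hE : (0 : ℝ) ≤ (Fintype.card (Edge 3 L) : ℝ) := Nat.cast_nonneg _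
  have hNP : (0 : ℝ) ≤ (Fintype.card (Plaquette 3 L × Fin 3) : ℝ) := Nat.cast_nonneg _
  have hT2 := sq_nonneg T
  have hR2 := sq_nonneg R
  have a1 : α ^ 2 ≤ α' ^ 2 := pow_le_pow_left₀ hα0 hαα 2
  have h1 : α ^ 2 * T ^ 2 ≤ α' ^ 2 * T ^ 2 := mul_le_mul_of_nonneg_right a1 hT2
  have h2 : α * T ^ 2 ≤ α' * T ^ 2 := mul_le_mul_of_nonneg_right hαα hT2
  have h3 : α * (δ * Γ) ≤ α' * (δ * Γ) := mul_le_mul_of_nonneg_right hαα hδΓ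
  have h4 : α * ((Fintype.card (Plaquette 3 L × Fin 3) : ℝ) * R ^ 2) ≤ α' * ((Fintype.card (Plaquette 3 L × Fin 3) : ℝ) * R ^ 2) :=
    mul_le_mul_of_nonneg_right hαα (mul_nonneg hNP hR2)
  have k1 : (Fintype.card (Edge 3 L) : ℝ) * (558 * α ^ 2 * T ^ 2 + 192 * α * T ^ 2) ≤ (Fintype.card (Edge 3 L) : ℝ) * (558 * α' ^ 2 * T ^ 2 + 192 * α' * T ^ 2) :=
    mul_le_mul_of_nonneg_left (by linarith) hE
  have hk : β * ((Fintype.card (Edge 3 L) : ℝ) * (558 * α ^ 2 * T ^ 2 + 192 * α * T ^ 2) + 216 * α * δ * Γ) ≤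
      β * ((Fintype.card (Edge 3 L) : ℝ) * (558 * α' ^ 2 * T ^ 2 + 192 * α' * T ^ 2) + 216 * α' * δ * Γ) :=
    mul_le_mul_of_nonneg_left (by linarith) hβ
  have hm : β / 2 * (100 * σ * (Fintype.card (Plaquette 3 L × Fin 3) : ℝ) * R ^ 2 + 2 * stepActionErr (L := L) T σ +
      10080 * α * (Fintype.card (Plaquette 3 L × Fin 3) : ℝ) * R ^ 2) ≤ β / 2 * (100 * σ * (Fintype.card (Plaquette 3 L × Fin 3) : ℝ) * R ^ 2 + 2 * stepActionErr (L := L) T σ +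
      10080 * α' * (Fintype.card (Plaquette 3 L × Fin 3) : ℝ) * R ^ 2) :=
    mul_le_mul_of_nonneg_left (by linarith) (by positivity)
  linarith

/-! ## §2 The `α`-conjuncts, eventually, for a threshold family `6·β^{-1/2} ≤ α ≤ btAlpha` -/

/-- `0 ≤ D·recordDelta1 L (1/6) β` for `D ≥ 0`. [folklore] -/
theorem scaledDelta1_nonneg {D : ℝ} (hD : 0 ≤ D) (β : ℝ) : 0 ≤ D * recordDelta1 L (1 / 6) β := by
  unfold recordDelta1; exact mul_nonneg hD (div_nonneg (mul_nonneg (by norm_num) (powScale_pos _ _).le) (Nat.cast_nonneg _))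

/-- ★ **The elementary `α`-conjuncts at the rate window**, eventually, for any threshold family with `0 ≤ α`, `α ≤ btAlpha` and `6·powScale(1/2) ≤ α` eventually: `α ≤ 1`, the near
defect margin, the rough margin, and the far-junk inequality `hJ`. [folklore] -/
theorem eventually_alpha_elementary_D {D : ℝ} (hD : 1 ≤ D) {α : ℝ → ℝ} (hα0 : ∀ᶠ β : ℝ in atTop, 0 ≤ α β) (hαU : ∀ᶠ β : ℝ in atTop, α β ≤ btAlpha β)
    (hαL : ∀ᶠ β : ℝ in atTop, 6 * powScale (1 / 2) β ≤ α β) :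
    ∀ᶠ β : ℝ in atTop, α β ≤ 1 ∧
      0 ≤ btR1 β / 2 - 2 * (Real.sqrt 2 * btRad β + D * recordDelta1 L (1 / 6) β) * btEps β - (2 * Real.sqrt 2 * btRad β + α β) ∧
      0 ≤ 1 / (3 * L) - 4 * (Real.sqrt 2 * btRad β + D * recordDelta1 L (1 / 6) β) - (2 * Real.sqrt 2 * btRad β + α β) ∧
      2 * btEps β * Fintype.card (Site 3 L) * (D * recordDelta1 L (1 / 6) β) + 2 * btRad β ^ 2 +
          2 * Real.sqrt 2 * Fintype.card (Site 3 L) * (9 * L * (13 * (D * recordDelta1 L (1 / 6) β)) + btEps β) * btRad β ≤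
        Fintype.card (Site 3 L) * (1 - 3 * L * (13 * (D * recordDelta1 L (1 / 6) β))) * α β := by
  have hL1 : (1 : ℝ) ≤ L := by exact_mod_cast NeZero.one_le
  have hL0 : (0 : ℝ) < L := by linarith
  have hN1 : (1 : ℝ) ≤ Fintype.card (Site 3 L) := by exact_mod_cast Fintype.card_pos
  have hN : (0 : ℝ) < Fintype.card (Site 3 L) := by linarith
  have h2 : (0 : ℝ) < Real.sqrt 2 := Real.sqrt_pos.mpr (by norm_num)
  have h22 : Real.sqrt 2 < 2 := by
    have := Real.sqrt_lt_sqrt (by norm_num : (0 : ℝ) ≤ 2) (show (2 : ℝ) < 4 by norm_num)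
    rwa [show (4 : ℝ) = 2 ^ 2 by norm_num, Real.sqrt_sq (by norm_num : (0 : ℝ) ≤ 2)] at this
  filter_upwards [eventually_small_elementary_D (L := L) hD, eventually_rate_schedule_facts (L := L) hD, hα0, hαU, hαL] with β hel hf hα0β hU hLβ
  obtain ⟨-, -, hα1, -, -, -, -, hm₁, hm₂, h39, -, -⟩ := hel
  obtain ⟨hβ1, -, -, hreq, hεx, hxδ, -, -, hδs, hεs, hδhalf⟩ := hf
  refine ⟨hU.trans hα1, by linarith, by linarith, ?_⟩
  set x := powScale (1 / 2) β with hxdef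
  set δ := D * recordDelta1 L (1 / 6) β with hδdef
  have hx0 : 0 < x := powScale_pos _ _
  have hδ0 : 0 ≤ δ := scaledDelta1_nonneg (by linarith) β
  have hε0 : 0 < btEps β := powScale_pos _ _
  have hLδ : (L : ℝ) * δ < 1 / 4000 := by
    have := mul_lt_mul_of_pos_left hδs hL0; rwa [show (L : ℝ) * (1 / (4000 * L)) = 1 / 4000 by field_simp] at this
  rw [hreq]
  have h39' : 3 * (L : ℝ) * (13 * δ) ≤ 1 / 2 := by linarith
  have hRHS : Fintype.card (Site 3 L) * (1 / 2) * α β ≤ Fintype.card (Site 3 L) * (1 - 3 * L * (13 * δ)) * α β :=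
    mul_le_mul_of_nonneg_right (mul_le_mul_of_nonneg_left (by linarith) hN.le) hα0β
  have t1 : 2 * btEps β * Fintype.card (Site 3 L) * δ ≤ Fintype.card (Site 3 L) * x := by
    have h := mul_le_mul hεx hδhalf hδ0 hx0.le
    have := mul_le_mul_of_nonneg_left h (by positivity : (0 : ℝ) ≤ 2 * Fintype.card (Site 3 L))
    linarith
  have hxle : x ≤ 1 / 2 := by have := (btRad_pos_le β).2; rw [hreq] at this; linarith
  have t2 : 2 * x ^ 2 ≤ x := by nlinarith
  have t3 : 2 * Real.sqrt 2 * Fintype.card (Site 3 L) * (9 * L * (13 * δ) + btEps β) * x ≤ Fintype.card (Site 3 L) * x / 2 := by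
    have hin : 9 * (L : ℝ) * (13 * δ) + btEps β ≤ 117 / 4000 + 1 / 600 := by linarith
    have h1 := mul_le_mul_of_nonneg_left hin (by positivity : (0 : ℝ) ≤ 2 * Real.sqrt 2 * Fintype.card (Site 3 L) * x)
    have h2 := mul_le_mul_of_nonneg_right h22.le (by positivity : (0 : ℝ) ≤ Fintype.card (Site 3 L) * x)
    have hNx : 0 ≤ (Fintype.card (Site 3 L) : ℝ) * x := by positivity
    nlinarith [h1, h2, hNx]
  have hx' : x ≤ Fintype.card (Site 3 L) * x := le_mul_of_one_le_left hx0.le hN1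
  have hαN : Fintype.card (Site 3 L) * (6 * x) ≤ Fintype.card (Site 3 L) * α β := mul_le_mul_of_nonneg_left hLβ hN.le
  linarith

/-- ★ **`η(α) ≤ 1` eventually** at the rate window for any family `0 ≤ α ≤ btAlpha` (monotonicity + `eventually_coreEta_le_one_D`). [folklore] -/
theorem eventually_coreEta_alpha_le_one_D {D : ℝ} (hD : 1 ≤ D) {α : ℝ → ℝ} (hα0 : ∀ᶠ β : ℝ in atTop, 0 ≤ α β) (hαU : ∀ᶠ β : ℝ in atTop, α β ≤ btAlpha β) :
    ∀ᶠ β : ℝ in atTop,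
      coreEta L β (D * recordDelta1 L (1 / 6) β) (α β) (9 * L * btR1 β + btEps β) (btRad β) (btEps β * Fintype.card (Site 3 L))
        ((L : ℝ) ^ 3 * (12 * (D * recordDelta1 L (1 / 6) β) ^ 4)) ≤ 1 := by
  filter_upwards [eventually_coreEta_le_one_D (L := L) hD, hα0, hαU, eventually_ge_atTop (0 : ℝ)] with β h h0 hU hβ
  refine (coreEta_mono_alpha (L := L) hβ ?_ h0 hU).trans h
  exact mul_nonneg (scaledDelta1_nonneg (by linarith) β) (mul_nonneg (powScale_pos _ _).le (Nat.cast_nonneg _))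

/-- `f ≤ C₁δ² + C₂xℓ³` eventually ⟹ `f ≤ 1` eventually (`δ = D·recordDelta1 L (1/6) → 0`, `xℓ³ = powScale(1/2)·btLog³ → 0`). [folklore] -/
theorem eventually_le_one_of_le_C1C2 {f : ℝ → ℝ} {C₁ C₂ : ℝ} (D : ℝ)
    (h : ∀ᶠ β : ℝ in atTop, f β ≤ C₁ * (D * recordDelta1 L (1 / 6) β) ^ 2 + C₂ * (powScale (1 / 2) β * btLog β ^ 3)) :
    ∀ᶠ β : ℝ in atTop, f β ≤ 1 := by
  have hδt : Tendsto (fun β : ℝ => D * recordDelta1 L (1 / 6) β) atTop (𝓝 0) := by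
    simpa using (tendsto_recordDelta1 (L := L) (show (0 : ℝ) < 1 / 6 by norm_num)).const_mul D
  have h1 : Tendsto (fun β : ℝ => C₁ * (D * recordDelta1 L (1 / 6) β) ^ 2 + C₂ * (powScale (1 / 2) β * btLog β ^ 3)) atTop (𝓝 0) := by
    have := ((hδt.pow 2).const_mul C₁).add ((tendsto_powScale_mul_btLog_pow (show (0 : ℝ) < 1 / 2 by norm_num) 3).const_mul C₂)
    simpa using this
  filter_upwards [h, h1.eventually (eventually_le_nhds one_pos)] with β hf hs using hf.trans hs

/-- ★ **`η_s(α) ≤ 1` eventually** at the rate window (fibre radius `powScale (1/2)` in the `t, R` slots, `T = 9L·btR1 + btEps`, `Γ = btEps·|Site|`, `σ = 12L³δ⁴`) for any family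
`0 ≤ α ≤ A·powScale(1/2)·btLog`. [folklore] -/
theorem eventually_symEta_alpha_le_one_D {D A : ℝ} (hD : 1 ≤ D) (hA : 0 ≤ A) {α : ℝ → ℝ} (hα0 : ∀ᶠ β : ℝ in atTop, 0 ≤ α β)
    (hαA : ∀ᶠ β : ℝ in atTop, α β ≤ A * powScale (1 / 2) β * btLog β) :
    ∀ᶠ β : ℝ in atTop,
      β * ((Fintype.card (Edge 3 L) : ℝ) * (558 * α β ^ 2 * (9 * L * btR1 β + btEps β) ^ 2 + 192 * α β * (9 * L * btR1 β + btEps β) ^ 2) +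
            216 * α β * (D * recordDelta1 L (1 / 6) β) * (btEps β * Fintype.card (Site 3 L))) +
          β / 2 * (100 * ((L : ℝ) ^ 3 * (12 * (D * recordDelta1 L (1 / 6) β) ^ 4)) * (Fintype.card (Plaquette 3 L × Fin 3) : ℝ) * powScale (1 / 2) β ^ 2 +
            2 * stepActionErr (L := L) (powScale (1 / 2) β) ((L : ℝ) ^ 3 * (12 * (D * recordDelta1 L (1 / 6) β) ^ 4)) +
            10080 * α β * (Fintype.card (Plaquette 3 L × Fin 3) : ℝ) * powScale (1 / 2) β ^ 2) ≤ 1 := by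
  have hN : (0 : ℝ) < (Fintype.card (Site 3 L) : ℝ) := by exact_mod_cast Fintype.card_pos
  apply eventually_le_one_of_le_C1C2 (L := L) D
  filter_upwards [eventually_rate_schedule_facts₂ (L := L) hD, hα0, hαA] with β h hα0β hαβ
  obtain ⟨hβ1, -, hℓ1, -, -, -, hδ1, hx0, hx1, -, -, -, -, hT2, -, -, -, hσδ, hsσ, hΓ, hxl, hxl1⟩ := h
  have hxℓ : powScale (1 / 2) β * btLog β ≤ 1 := by rw [← hxl]; exact hxl1
  have hβ0 : 0 ≤ β := by linarith
  have hβx : β * powScale (1 / 2) β ^ 2 = 1 := mul_powScale_half_sq hβ1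
  have hΓ0 : 0 ≤ btEps β * (Fintype.card (Site 3 L) : ℝ) := mul_nonneg (powScale_pos _ _).le hN.le
  have hAT : (0 : ℝ) ≤ 2116 * (L : ℝ) ^ 2 := by positivity
  exact symEta_le_atom (L := L) hβ0 hδ1 hℓ1 hx0 hx1 hxℓ hβx hT2 hAT hA hα0β hαβ hσδ hsσ hΓ0 hΓ.le hN.le

/-! ## §3 The threshold `α_r = A·powScale(1/2)·√btLog` qualifies -/

/-- `0 ≤ α_r`. [folklore] -/
theorem alphaR_nonneg {A : ℝ} (hA : 0 ≤ A) (β : ℝ) : 0 ≤ A * powScale (1 / 2) β * Real.sqrt (btLog β) :=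
  mul_nonneg (mul_nonneg hA (powScale_pos _ _).le) (Real.sqrt_nonneg _)

/-- `α_r ≤ A·powScale(1/2)·btLog` (`√ℓ ≤ ℓ` for `ℓ ≥ 1`). [folklore] -/
theorem alphaR_le_mul_btLog {A : ℝ} (hA : 0 ≤ A) (β : ℝ) : A * powScale (1 / 2) β * Real.sqrt (btLog β) ≤ A * powScale (1 / 2) β * btLog β := by
  have hℓ := one_le_btLog β
  refine mul_le_mul_of_nonneg_left ?_ (mul_nonneg hA (powScale_pos _ _).le)
  calc Real.sqrt (btLog β) ≤ Real.sqrt (btLog β ^ 2) := Real.sqrt_le_sqrt (by nlinarith)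
    _ = btLog β := Real.sqrt_sq (by linarith)

/-- ★ `α_r ≤ btAlpha` eventually (`A ≤ √ℓ` once `log β ≥ A²`). [folklore] -/
theorem eventually_alphaR_le_btAlpha (A : ℝ) : ∀ᶠ β : ℝ in atTop, A * powScale (1 / 2) β * Real.sqrt (btLog β) ≤ btAlpha β := by
  filter_upwards [Real.tendsto_log_atTop.eventually_ge_atTop (A ^ 2)] with β hA2
  have hℓA : A ^ 2 ≤ btLog β := hA2.trans (le_max_left _ _)
  have hℓ0 : 0 ≤ btLog β := le_trans zero_le_one (one_le_btLog β)
  have hsA : A ≤ Real.sqrt (btLog β) := by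
    calc A ≤ |A| := le_abs_self A
      _ = Real.sqrt (A ^ 2) := (Real.sqrt_sq_eq_abs A).symm
      _ ≤ Real.sqrt (btLog β) := Real.sqrt_le_sqrt hℓA
  have hx0 : 0 ≤ powScale (1 / 2) β := (powScale_pos _ _).le
  have hs0 : 0 ≤ Real.sqrt (btLog β) := Real.sqrt_nonneg _
  unfold btAlpha
  calc A * powScale (1 / 2) β * Real.sqrt (btLog β) ≤ Real.sqrt (btLog β) * powScale (1 / 2) β * Real.sqrt (btLog β) :=
        mul_le_mul_of_nonneg_right (mul_le_mul_of_nonneg_right hsA hx0) hs0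
    _ = powScale (1 / 2) β * (Real.sqrt (btLog β) * Real.sqrt (btLog β)) := by ring
    _ = powScale (1 / 2) β * btLog β := by rw [Real.mul_self_sqrt hℓ0]

/-- ★ `6·powScale(1/2) ≤ α_r` eventually (`A ≥ 1`, `√ℓ ≥ 6` once `log β ≥ 36`). [folklore] -/
theorem eventually_six_powScale_le_alphaR {A : ℝ} (hA : 1 ≤ A) : ∀ᶠ β : ℝ in atTop, 6 * powScale (1 / 2) β ≤ A * powScale (1 / 2) β * Real.sqrt (btLog β) := by
  filter_upwards [Real.tendsto_log_atTop.eventually_ge_atTop (36 : ℝ)] with β h36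
  have hℓ36 : (36 : ℝ) ≤ btLog β := h36.trans (le_max_left _ _)
  have hs6 : 6 ≤ Real.sqrt (btLog β) := by
    rw [show (6 : ℝ) = Real.sqrt (6 ^ 2) by rw [Real.sqrt_sq (by norm_num)]]
    exact Real.sqrt_le_sqrt (by norm_num; linarith)
  have hx0 : 0 ≤ powScale (1 / 2) β := (powScale_pos _ _).le
  calc 6 * powScale (1 / 2) β ≤ (A * Real.sqrt (btLog β)) * powScale (1 / 2) β := by
        refine mul_le_mul_of_nonneg_right ?_ hx0
        calc (6 : ℝ) = 1 * 6 := (one_mul 6).symm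
          _ ≤ A * Real.sqrt (btLog β) := mul_le_mul hA hs6 (by norm_num) (by linarith)
    _ = A * powScale (1 / 2) β * Real.sqrt (btLog β) := by ring

end Summit.QuantumFields.YangMills.Theorems.FemtoTransferGap.TwoLattice.ConstTube

end
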